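import Literature.Topology.FourManifolds.ClosedBallSmoothEmbeddings
import Literature.Topology.FourManifolds.DisjointFamilyIsotopy
import HarnessLib

/-!
# Finite disjoint families of embeddings of a manifold with corners, glued on `DiscreteIndex ι × M`

Topic `Literature/Topology/FourManifolds`; general infrastructure complementing
`DisjointFamilyIsotopy.lean`, whose `isSmoothEmbedding_familyMap` glues a finite family of smooth
embeddings `e i : M → N` with pairwise disjoint images into one smooth embedding of the disjoint
sum `DiscreteIndex ι × M` (`SphereFamilySurgery.lean`: the index type as a `0`-manifold) — but
only for a source `M` modelled on a **boundaryless** model, because it goes through the rank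
criterion `isSmoothEmbedding_of_injective_of_injective_mfderiv` (`ImmersionCriterion.lean`).
For the fact seat of `Literature.Topology.FourManifolds.arcs_ambientIsotopic_rel_of_homotopicRel`
(`OneHandleUniqueness.lean`) the members are compact arcs `𝔻¹ → X`, manifolds with boundary, so
the gluing is done here directly at the level of Mathlib's chart definition of immersions:

* `isImmersionAtOfComplement_familyMap` — if `e i` is an immersion at `x` in Mathlib's chart
  sense with complement `Fc` (`Manifold.IsImmersionAtOfComplement`), then the glued map
  `(j, y) ↦ e j y` is an immersion at `(i, x)` for the product model `(𝓡 0).prod I` with the same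
  complement: the domain chart is the product of the constant chart of the index manifold at `i`
  with the immersion chart of `e i`, the codomain chart is unchanged, and the linear normal form is
  precomposed with `ℝ⁰ × E ≅ E` (any model `I`, corners allowed);
* `isImmersionOfComplement_familyMap`, `isSmoothEmbedding_familyMap_of_complement` — hence a
  finite family of injective immersions (one complement for all members and points) of a compact
  `M` with pairwise disjoint images glues to a smooth embedding of `DiscreteIndex ι × M`;
* `isSmoothEmbedding_familyMap_closedBall` — the case of closed balls: if
  `G i : ℝᵏ⁺¹ → N` are `C^∞` maps into a manifold modelled on `ℝᵐ`, injective with injective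
  differential on `𝔻ᵏ⁺¹` and with pairwise disjoint images of `𝔻ᵏ⁺¹`, then
  `(i, x) ↦ G i x` is a smooth embedding of `DiscreteIndex ι × 𝔻ᵏ⁺¹` (model
  `(𝓡 0).prod (𝓡∂ (k + 1))`), by `isImmersionAtOfComplement_comp_coe_closedBall`
  (`ClosedBallSmoothEmbeddings.lean`) and the rank criterion for the open manifold `ℝᵏ⁺¹`.

Everything here is proved; no definitions and no named facts are introduced.

## References

* J. M. Lee, *Introduction to Smooth Manifolds*, 2nd ed., GTM 218 (2013), Ch. 4 (Thm. 4.12,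
  Thm. 4.15) and Ch. 5 (Prop. 5.22). [LeeSmoothManifolds2013]
* M. W. Hirsch, *Differential Topology*, GTM 33 (1976), Ch. 1 §3 Thm. 3.1; Ch. 8 §1 (an isotopy
  of a compact submanifold with several components). [HirschDT1976]
-/

open scoped Manifold ContDiff Topology
open Set Function Metric

noncomputable section

namespace Literature.Topology.FourManifolds

section General

variable {EM HM EN HN : Type*} [NormedAddCommGroup EM] [NormedSpace ℝ EM] [TopologicalSpace HM]
  [NormedAddCommGroup EN] [NormedSpace ℝ EN] [TopologicalSpace HN]
  {I : ModelWithCorners ℝ EM HM} {J : ModelWithCorners ℝ EN HN}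
  {M : Type*} [TopologicalSpace M] [ChartedSpace HM M]
  {N : Type*} [TopologicalSpace N] [ChartedSpace HN N]
  {ι : Type*} {Fc : Type*} [NormedAddCommGroup Fc] [NormedSpace ℝ Fc]

-- the model `ModelProd ℝ⁰ HM` of the product is `ℝ⁰ × HM` by definition
set_option backward.isDefEq.respectTransparency false in
/-- **The glued map of a family is an immersion at `(i, x)` if the `i`-th member is an immersion
at `x`** (Mathlib's chart definition `Manifold.IsImmersionAtOfComplement`, same complement `Fc`;
source `M` over any model with corners `I`, the disjoint sum `DiscreteIndex ι × M` over
`(𝓡 0).prod I`).  Charts: the product of the constant chart of `DiscreteIndex ι` at `i` (source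
`{i}`) with the immersion chart of `e i` at `x`, the immersion chart of `N` at `e i x`, and the
normal form `((z, u), w) ↦ equiv (u, w)` through `ℝ⁰ × E ≅ E`.  Lee (2013), Ch. 4. [folklore] -/
theorem isImmersionAtOfComplement_familyMap [IsManifold I ∞ M] [IsManifold J ∞ N]
    {e : ι → M → N} {i : DiscreteIndex ι} {x : M}
    (h : Manifold.IsImmersionAtOfComplement Fc I J ∞ (e (DiscreteIndex.mk.symm i)) x) :
    Manifold.IsImmersionAtOfComplement Fc ((𝓡 0).prod I) J ∞
      (fun p : DiscreteIndex ι × M => e (DiscreteIndex.mk.symm p.1) p.2) (i, x) := by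
  have hcont : ContinuousAt (fun p : DiscreteIndex ι × M => e (DiscreteIndex.mk.symm p.1) p.2)
      (i, x) := by
    have h1 : ContinuousAt (e (DiscreteIndex.mk.symm i) ∘ Prod.snd) ((i, x) : DiscreteIndex ι × M) :=
      h.continuousAt.comp continuousAt_snd
    exact h1.congr (familyMap_eventuallyEq e i x).symm
  refine Manifold.IsImmersionAtOfComplement.mk_of_continuousAt hcont
    (((ContinuousLinearEquiv.uniqueProd ℝ EM (EuclideanSpace ℝ (Fin 0))).prodCongr
      (ContinuousLinearEquiv.refl ℝ Fc)).trans h.equiv)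
    ((chartAt (EuclideanSpace ℝ (Fin 0)) i).prod h.domChart) h.codChart
    ⟨mem_chart_source _ i, h.mem_domChart_source⟩ h.mem_codChart_source
    (IsManifold.mem_maximalAtlas_prod (IsManifold.chart_mem_maximalAtlas i)
      h.domChart_mem_maximalAtlas) h.codChart_mem_maximalAtlas ?_
  intro y hy
  rw [OpenPartialHomeomorph.extend_prod, PartialEquiv.prod_target] at hy
  have key := h.writtenInCharts hy.2
  simp only [comp_apply] at key
  have hsymm : (((chartAt (EuclideanSpace ℝ (Fin 0)) i).prod h.domChart).extend ((𝓡 0).prod I)).symm y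
      = (i, (h.domChart.extend I).symm y.2) := by
    rw [OpenPartialHomeomorph.extend_prod, PartialEquiv.prod_coe_symm]
    rfl
  simp only [comp_apply]
  rw [hsymm]
  change (h.codChart.extend J) (e (DiscreteIndex.mk.symm i) ((h.domChart.extend I).symm y.2)) = _
  rw [key]
  simp

/-- **The glued map of a family of immersions (one complement for all members and points) is an
immersion of the disjoint sum**, with the same complement. [folklore] -/
theorem isImmersionOfComplement_familyMap [IsManifold I ∞ M] [IsManifold J ∞ N]
    {e : ι → M → N} (h : ∀ i x, Manifold.IsImmersionAtOfComplement Fc I J ∞ (e i) x) :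
    Manifold.IsImmersionOfComplement Fc ((𝓡 0).prod I) J ∞
      (fun p : DiscreteIndex ι × M => e (DiscreteIndex.mk.symm p.1) p.2) := fun p =>
  isImmersionAtOfComplement_familyMap (h _ p.2)

/-- **A finite disjoint family of injective immersions of a compact manifold with corners glues
to a smooth embedding of the disjoint sum** (Mathlib's `Manifold.IsSmoothEmbedding` for the
product model `(𝓡 0).prod I`): an immersion by `isImmersionOfComplement_familyMap`, a
topological embedding as a continuous injection of a compact space into a Hausdorff space
(Hirsch (1976), Ch. 1 §3, Thm. 3.1). [cite: HirschDT1976, Ch. 1 §3 Thm. 3.1] -/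
theorem isSmoothEmbedding_familyMap_of_complement [IsManifold I ∞ M] [IsManifold J ∞ N]
    [Finite ι] [CompactSpace M] [T2Space N] {e : ι → M → N}
    (h : ∀ i x, Manifold.IsImmersionAtOfComplement Fc I J ∞ (e i) x)
    (hinj : ∀ i, Injective (e i)) (hd : ∀ i j, i ≠ j → ∀ x y, e i x ≠ e j y) :
    Manifold.IsSmoothEmbedding ((𝓡 0).prod I) J ∞
      (fun p : DiscreteIndex ι × M => e (DiscreteIndex.mk.symm p.1) p.2) := by
  refine ⟨(isImmersionOfComplement_familyMap h).isImmersion, ?_⟩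
  have hc : Continuous (fun p : DiscreteIndex ι × M => e (DiscreteIndex.mk.symm p.1) p.2) :=
    (contMDiff_familyMap (I := I) (J := J) (n := ∞)
      fun i => Manifold.IsImmersionOfComplement.contMDiff (h i)).continuous
  exact (hc.isClosedEmbedding (injective_familyMap hinj hd)).isEmbedding

end General

/-! ### Families of closed balls -/

section ClosedBall

variable {k m : ℕ} {N : Type*} [TopologicalSpace N] [ChartedSpace (EuclideanSpace ℝ (Fin m)) N]
  [IsManifold (𝓡 m) ∞ N] {ι : Type*}

/-- **A finite disjoint family of embedded closed balls is a smooth embedding of the disjoint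
sum `DiscreteIndex ι × 𝔻ᵏ⁺¹`.**  Let `G i : ℝᵏ⁺¹ → N` (`i : ι` finite, `N` Hausdorff, modelled
on `ℝᵐ`) be `C^∞`, injective on the closed unit ball `𝔻ᵏ⁺¹` with injective differential at
every point of it, with pairwise disjoint images of `𝔻ᵏ⁺¹`.  Then `(i, x) ↦ G i x` is a smooth
embedding of `DiscreteIndex ι × 𝔻ᵏ⁺¹` (manifold with boundary, model `(𝓡 0).prod (𝓡∂ (k + 1))`)
in Mathlib's sense: each member is an immersion of `𝔻ᵏ⁺¹` with the fixed complement
`ℝ^{m-(k+1)}` (`isImmersionAtOfComplement_comp_coe_closedBall` after the rank criterion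
`isImmersionAtOfComplement_of_injective_mfderiv` for `ℝᵏ⁺¹`), and the family glues by
`isSmoothEmbedding_familyMap_of_complement`.  This is the form in which a finite union of
disjoint compact arcs (`k = 0`) is the source of a smooth isotopy
(`Literature.Topology.FourManifolds.SmoothIsotopy`). Lee (2013), Thm. 4.15 and Prop. 4.22 (c).
[cite: LeeSmoothManifolds2013, Ch. 4 Thm. 4.15] -/
theorem isSmoothEmbedding_familyMap_closedBall [T2Space N] [Finite ι]
    {G : ι → EuclideanSpace ℝ (Fin (k + 1)) → N} (hG : ∀ i, ContMDiff (𝓡 (k + 1)) (𝓡 m) ∞ (G i))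
    (hinj : ∀ i, InjOn (G i) (Metric.closedBall (0 : EuclideanSpace ℝ (Fin (k + 1))) 1))
    (hd : ∀ i, ∀ y ∈ Metric.closedBall (0 : EuclideanSpace ℝ (Fin (k + 1))) 1,
      Injective (mfderiv (𝓡 (k + 1)) (𝓡 m) (G i) y))
    (hdis : ∀ i j, i ≠ j → ∀ y ∈ Metric.closedBall (0 : EuclideanSpace ℝ (Fin (k + 1))) 1,
      ∀ y' ∈ Metric.closedBall (0 : EuclideanSpace ℝ (Fin (k + 1))) 1, G i y ≠ G j y') :
    Manifold.IsSmoothEmbedding ((𝓡 0).prod (𝓡∂ (k + 1))) (𝓡 m) ∞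
      (fun p : DiscreteIndex ι × Metric.closedBall (0 : EuclideanSpace ℝ (Fin (k + 1))) 1 =>
        G (DiscreteIndex.mk.symm p.1) p.2) := by
  have himm : ∀ (i : ι) (x : Metric.closedBall (0 : EuclideanSpace ℝ (Fin (k + 1))) 1),
      Manifold.IsImmersionAtOfComplement
        (Fin (Module.finrank ℝ (EuclideanSpace ℝ (Fin m)) -
          Module.finrank ℝ (EuclideanSpace ℝ (Fin (k + 1)))) → ℝ)
        (𝓡∂ (k + 1)) (𝓡 m) ∞
        (G i ∘ Subtype.val : Metric.closedBall (0 : EuclideanSpace ℝ (Fin (k + 1))) 1 → N) x :=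
    fun i x => isImmersionAtOfComplement_comp_coe_closedBall
      (isImmersionAtOfComplement_of_injective_mfderiv (I := 𝓡 (k + 1)) (J := 𝓡 m) isOpen_univ
        (mem_univ _) (hG i).contMDiffOn (by exact_mod_cast le_top) (hd i x x.2))
  have hinj' : ∀ i, Injective
      (G i ∘ Subtype.val : Metric.closedBall (0 : EuclideanSpace ℝ (Fin (k + 1))) 1 → N) :=
    fun i a b hab => Subtype.ext (hinj i a.2 b.2 hab)
  have hd' : ∀ i j, i ≠ j → ∀ x y : Metric.closedBall (0 : EuclideanSpace ℝ (Fin (k + 1))) 1,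
      (G i ∘ Subtype.val) x ≠ (G j ∘ Subtype.val) y :=
    fun i j hij x y => hdis i j hij x x.2 y y.2
  exact isSmoothEmbedding_familyMap_of_complement himm hinj' hd'

end ClosedBall

end Literature.Topology.FourManifolds
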